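import Literature.Computability.MetaComplexity.EFModAddUMFI
import HarnessLib

/-!
# Left distributivity of uniform modular multiplication, part 1: the mask block and `0 ⊕ 0 = 0`

Layer E/4 (uniform variant), preparations for `(x ⊕ y) ⊗ b = (x ⊗ b) ⊕ (y ⊗ b)`
(`EFModMulULD.lean`). Two ingredients that do not fit the carry-induction mould directly:

* `ModMulU.LD.isBlock_maskLines` — **the masks distribute**: for a bit `g` and the masks
  `mx = g ∧ x`, `my = g ∧ y`, `mS = g ∧ s` where `s = R(x ⊕ y)`, the modular sum `mx ⊕ my`
  equals `mS` bitwise. By a case analysis on `g` (`EFLogic.lean`): if `g`, the masks are their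
  words and congruence applies; if `¬g`, all masks are false and `0 ⊕ 0` has false output bits
  (system `ZADDF`: false sum bits at every position, and `¬ge` from `a < n` at the end).
* `ModMulU.LD.modDefList` — the definition lines of a modular adder as a list (for weakening
  its availability into a case context).

## Sources

* S. A. Cook, R. A. Reckhow, *The relative efficiency of propositional proof systems*,
  J. Symbolic Logic 44 (1979), §2.
-/

namespace Literature.Computability.MetaComplexity

open _root_.Computability Complexity Complexity.PropForm Netlist Cluster FregeSystem

namespace ModMulU

namespace LD

/-! ### Rules and the system `ZADDF` -/

/-- `R ↔ mux(ge, d, s)`, `¬ge`, `¬s` give `¬R`. [cite: CookReckhow1979, §2 (sound rule)] -/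
def rMuxFF : FregeRule :=
  ⟨[ctx (var 0) (biimp (var 1) (muxF (var 2) (var 3) (var 4))), ctx (var 0) (neg (var 2)), ctx (var 0) (neg (var 4))],
    ctx (var 0) (neg (var 1))⟩

/-- **System `ZADDF`**: the modular adder `x ⊕ y` on bitwise false operands (premise shapes `¬x`, `¬y`), with the comparator `(a, n)`: every sum bit is false (per-position rule) and `a < n` gives `¬ge` (end rule).
Leaves: 1 ka, 2 gm, 3 al, 4 x, 5 y, 6 n, 7 a; defined: 8 s, 9 ka2, 10 nD, 11 gm2, 12 nA, 13 al2. Invariant: the reachable carry states (2 terms). [folklore] -/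
def ZADDF : System where
  cins := [biimp (var 1) (const false), biimp (var 2) (const true), biimp (var 3) (const true)]
  shapes := [biimp (var 8) (xor3F (var 4) (var 5) (var 1)),
    biimp (var 9) (majF (var 4) (var 5) (var 1)),
    biimp (var 10) (neg (var 6)),
    biimp (var 11) (majF (var 8) (var 10) (var 2)),
    biimp (var 12) (neg (var 6)),
    biimp (var 13) (majF (var 7) (var 12) (var 3)),
    neg (var 4),
    neg (var 5)]
  inv := (disj (conj (neg (var 1)) (neg (var 2))) (conj (neg (var 1)) (var 3)))
  next := fun k => if k = 1 then 9 else if k = 2 then 11 else if k = 3 then 13 else k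

/-- Per-position rule of `ZADDF`: the sum bit is false. [cite: CookReckhow1979, §2 (sound rule)] -/
def rZADDFPos : FregeRule := ZADDF.endRule ZADDF.shapes (neg (var 8))

/-- End rule of `ZADDF`: `¬α` gives `¬γ`. [cite: CookReckhow1979, §2 (sound rule)] -/
def rZADDFEnd : FregeRule := ZADDF.endRule [neg (var 3)] (neg (var 2))

/-- The rules of the mask block. [cite: CookReckhow1979, §2] -/
def maskRules : List FregeRule := [ZADDF.baseRule, ZADDF.stepRule, rZADDFPos, rZADDFEnd, rMuxFF]

/-- Every rule of the mask block is sound. [cite: CookReckhow1979, §2 (sound rule)] -/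
theorem isSound_of_mem_maskRules : ∀ r ∈ maskRules, r.IsSound := by
  intro r hr
  simp only [maskRules, List.mem_cons, List.not_mem_nil, or_false] at hr
  rcases hr with rfl | rfl | rfl | rfl | rfl
  · exact FregeRule.isSound_of_check (by decide +kernel)
  · exact FregeRule.isSound_of_checkD (V := 8) (ds := ZADDF.ds) (by decide +kernel)
  · exact FregeRule.isSound_of_checkD (V := 8) (ds := ZADDF.ds) (by decide +kernel)
  · exact FregeRule.isSound_of_check (by decide +kernel)
  · exact FregeRule.isSound_of_check (by decide +kernel)

/-- The leaf side conditions of `ZADDF`. [folklore] -/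
theorem zaddfLeavesOK : ZADDF.LeavesOK := System.leavesOK_of_leavesOKB (by decide +kernel)

/-- Membership in `maskRules` by position. [folklore] -/
theorem mem_maskRules {i : ℕ} (hi : i < maskRules.length) : maskRules[i] ∈ maskRules := List.getElem_mem hi

/-! ### The definition lines of a modular adder as a list -/

/-- The definition lines of a modular-adder view. [folklore] -/
def modDefList (M : ModAddU.View) (L : ℕ) : List (PropForm ℕ) :=
  [M.S.cinDef false] ++ ((List.range L).map M.S.sumDef ++ ((List.range L).map M.S.carryDef ++
    (ModAddU.AssocData.subDefList (M.D L) L ++ (List.range L).map (M.muxDef L))))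

/-- Availability from the definition list. [folklore] -/
theorem modAvail_of_forall {M : ModAddU.View} {L : ℕ} {K : PropForm ℕ} {T : Set (PropForm ℕ)}
    (h : ∀ θ ∈ modDefList M L, ctx K θ ∈ T) : M.Avail K T L := by
  refine ⟨⟨h _ (List.mem_append_left _ (List.mem_singleton_self _)), fun i hi => ⟨?_, ?_⟩⟩,
    ModAddU.AssocData.subAvail_of_forall fun θ hθ => h _ ?_, fun i hi => h _ ?_⟩
  · exact h _ (List.mem_append_right _ (List.mem_append_left _ (List.mem_map.2 ⟨i, List.mem_range.2 hi, rfl⟩)))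
  · exact h _ (List.mem_append_right _ (List.mem_append_right _ (List.mem_append_left _
      (List.mem_map.2 ⟨i, List.mem_range.2 hi, rfl⟩))))
  · exact List.mem_append_right _ (List.mem_append_right _ (List.mem_append_right _ (List.mem_append_left _ hθ)))
  · exact List.mem_append_right _ (List.mem_append_right _ (List.mem_append_right _ (List.mem_append_right _
      (List.mem_map.2 ⟨i, List.mem_range.2 hi, rfl⟩))))

/-- The definition list from availability. [folklore] -/
theorem forall_of_modAvail {M : ModAddU.View} {L : ℕ} {K : PropForm ℕ} {T : Set (PropForm ℕ)} (h : M.Avail K T L) :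
    ∀ θ ∈ modDefList M L, ctx K θ ∈ T := by
  intro θ hθ
  simp only [modDefList, List.mem_append, List.mem_singleton, List.mem_map, List.mem_range] at hθ
  rcases hθ with rfl | ⟨i, hi, rfl⟩ | ⟨i, hi, rfl⟩ | hθ | ⟨i, hi, rfl⟩
  exacts [h.1.1, (h.1.2 i hi).1, (h.1.2 i hi).2, ModAddU.AssocData.forall_of_subAvail h.2.1 θ hθ, h.2.2 i hi]

/-- The items of the definition list are small. [folklore] -/
theorem size_le_of_mem_modDefList {M : ModAddU.View} {L : ℕ} {θ : PropForm ℕ} (h : θ ∈ modDefList M L) : θ.size ≤ 57 := by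
  simp only [modDefList, List.mem_append, List.mem_singleton, List.mem_map, List.mem_range] at h
  rcases h with rfl | ⟨i, -, rfl⟩ | ⟨i, -, rfl⟩ | h | ⟨i, -, rfl⟩
  · rw [(ModAddU.AssocData.size_defs M.S (M.D L) 0 false).2.2.1]; omega
  · rw [(ModAddU.AssocData.size_defs M.S (M.D L) i false).1]
  · rw [(ModAddU.AssocData.size_defs M.S (M.D L) i false).2.1]; omega
  · exact ModAddU.AssocData.size_le_of_mem_subDefList h
  · rw [ModAddU.View.muxDef, FregeSystem.size_biimp]; simp [size, muxF]

/-- Length of the definition list. [folklore] -/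
theorem length_modDefList (M : ModAddU.View) (L : ℕ) : (modDefList M L).length = 6 * L + 2 := by
  simp [modDefList, ModAddU.AssocData.subDefList]; ring

/-! ### The mask block -/

/-- The data of the mask block: the bit `g`, the words `x, y`, the modulus word `nw`, the masks
`mx, my, mS`, the modular adders `MS = x ⊕ y` (with `s = R(MS)`) and `MM = mx ⊕ my`, and a
comparator `CA = (xa, nw)` known to answer `<`. [folklore] -/
structure MaskData where
  /-- the width -/
  L : ℕ
  /-- the bit -/
  g : ℕ
  /-- first word -/
  x : ℕ → ℕ
  /-- second word -/
  y : ℕ → ℕ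
  /-- the modulus word -/
  nw : ℕ → ℕ
  /-- mask of `x` -/
  mx : ℕ → ℕ
  /-- mask of `y` -/
  my : ℕ → ℕ
  /-- mask of `s` -/
  mS : ℕ → ℕ
  /-- base of `MS = x ⊕ y` -/
  bMS : ℕ
  /-- base of `MM = mx ⊕ my` -/
  bMM : ℕ
  /-- base of the comparator -/
  bCA : ℕ
  /-- the compared word -/
  xa : ℕ → ℕ

namespace MaskData

variable (d : MaskData)

/-- `MS = x ⊕ y`. [folklore] -/
def MS : ModAddU.View := ⟨d.bMS, d.x, d.y, d.nw⟩
/-- `s = R(MS)`. [folklore] -/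
def s (i : ℕ) : ℕ := d.MS.R d.L i
/-- `MM = mx ⊕ my`. [folklore] -/
def MM : ModAddU.View := ⟨d.bMM, d.mx, d.my, d.nw⟩
/-- The comparator. [folklore] -/
def CA : Sub.View := ⟨d.bCA, d.xa, d.nw⟩
/-- The definition of a mask gate `m ↔ g ∧ w`. [folklore] -/
def mdef (mk w : ℕ) : PropForm ℕ := biimp (var mk) (conj (var d.g) (var w))
/-- The mask definition lines. [folklore] -/
def maskDefs : List (PropForm ℕ) :=
  (List.range d.L).map (fun i => d.mdef (d.mx i) (d.x i)) ++ ((List.range d.L).map (fun i => d.mdef (d.my i) (d.y i)) ++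
    (List.range d.L).map (fun i => d.mdef (d.mS i) (d.s i)))

/-- The positive context (`g` assumed). [folklore] -/
def KT (K : PropForm ℕ) : PropForm ℕ := disj K (neg (var d.g))
/-- The negative context (`¬g` assumed). [folklore] -/
def KF (K : PropForm ℕ) : PropForm ℕ := disj K (var d.g)

/-- The lines weakened into the positive branch. [folklore] -/
def wkT : List (PropForm ℕ) := modDefList d.MM d.L ++ (modDefList d.MS d.L ++ d.maskDefs)
/-- The lines weakened into the negative branch. [folklore] -/
def wkF : List (PropForm ℕ) :=
  modDefList d.MM d.L ++ (ModAddU.AssocData.subDefList d.CA d.L ++ (d.maskDefs ++ [neg (var (d.CA.ge d.L d.L))]))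

/-- Leaf assignment of `ZADDF`. [folklore] -/
def act (i : ℕ) (k : ℕ) : ℕ :=
  [0, d.MM.S.c i, d.MM.Dc d.L i, d.CA.ge d.L i, d.mx i, d.my i, d.nw i, d.xa i, d.MM.S.s i, d.MM.S.c (i + 1),
    (d.MM.D d.L).ny i, d.MM.Dc d.L (i + 1), d.CA.ny i, d.CA.ge d.L (i + 1)].getD k 0

/-- The segments of the positive branch. [folklore] -/
def segsT (K : PropForm ℕ) : List (List (PropForm ℕ)) :=
  [[ctx (d.KT K) (var d.g)],
   Logic.weakLines K (neg (var d.g)) d.wkT,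
   (List.range d.L).map (fun i => ctx (d.KT K) (eqv (d.mx i) (d.x i))),
   (List.range d.L).map (fun i => ctx (d.KT K) (eqv (d.my i) (d.y i))),
   (List.range d.L).map (fun i => ctx (d.KT K) (eqv (d.mS i) (d.s i))),
   Adder.reflLines (d.KT K) ((List.range d.L).map d.nw),
   (⟨d.MM, d.MS, d.L⟩ : ModAddU.PairData).leibLines (d.KT K),
   (List.range d.L).map (fun i => ctx (d.KT K) (eqv (d.mS i) (d.MM.R d.L i)))]

/-- The segments of the negative branch. [folklore] -/
def segsF (K : PropForm ℕ) : List (List (PropForm ℕ)) :=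
  [[ctx (d.KF K) (neg (var d.g))],
   Logic.weakLines K (var d.g) d.wkF,
   (List.range d.L).map (fun i => ctx (d.KF K) (neg (var (d.mx i)))),
   (List.range d.L).map (fun i => ctx (d.KF K) (neg (var (d.my i)))),
   (List.range d.L).map (fun i => ctx (d.KF K) (neg (var (d.mS i)))),
   ZADDF.lines (d.KF K) d.act d.L,
   (List.range d.L).map (fun i => ctx (d.KF K) (inst (d.act i) (neg (var 8)))),
   [ctx (d.KF K) (inst (d.act d.L) (neg (var 2)))],
   (List.range d.L).map (fun i => ctx (d.KF K) (neg (var (d.MM.R d.L i)))),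
   (List.range d.L).map (fun i => ctx (d.KF K) (eqv (d.mS i) (d.MM.R d.L i)))]

/-- The conclusions: `mSᵢ ↔ R(MM)ᵢ`. [folklore] -/
def concls : List (PropForm ℕ) := (List.range d.L).map fun i => eqv (d.mS i) (d.MM.R d.L i)

/-- **The lines of the mask block.** [folklore] -/
def maskLines (K : PropForm ℕ) : List (PropForm ℕ) :=
  (d.segsT K).flatten ++ (d.segsF K).flatten ++ Logic.mergeLines K d.concls

variable {G : FregeSystem} {K : PropForm ℕ} {Γ : Set (PropForm ℕ)}

/-- Membership of the mask definitions. [folklore] -/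
theorem mem_maskDefs {i : ℕ} (hi : i < d.L) : d.mdef (d.mx i) (d.x i) ∈ d.maskDefs ∧ d.mdef (d.my i) (d.y i) ∈ d.maskDefs ∧
    d.mdef (d.mS i) (d.s i) ∈ d.maskDefs :=
  ⟨List.mem_append_left _ (List.mem_map.2 ⟨i, List.mem_range.2 hi, rfl⟩),
    List.mem_append_right _ (List.mem_append_left _ (List.mem_map.2 ⟨i, List.mem_range.2 hi, rfl⟩)),
    List.mem_append_right _ (List.mem_append_right _ (List.mem_map.2 ⟨i, List.mem_range.2 hi, rfl⟩))⟩

/-- **The positive branch**: under `g`, the masks are the words, `MM ≡ MS`, so `mS ≡ R(MM)`.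
[cite: CookReckhow1979, §2] -/
theorem isBlock_segsT (hGN : ∀ r ∈ Netlist.rules, r ∈ G.rules) (hGA : ∀ r ∈ Adder.rules, r ∈ G.rules)
    (hGL : ∀ r ∈ Logic.rules, r ∈ G.rules) (hGG : ∀ r ∈ ModAddU.glueRules, r ∈ G.rules) {T : Set (PropForm ℕ)}
    (hMM : d.MM.Avail K T d.L) (hMS : d.MS.Avail K T d.L) (hmk : ∀ θ ∈ d.maskDefs, ctx K θ ∈ T) :
    G.IsBlock T (d.segsT K).flatten := by
  have hwk : ∀ θ ∈ d.wkT, ctx K θ ∈ T := fun θ hθ => by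
    rcases List.mem_append.1 hθ with hθ | hθ
    · exact forall_of_modAvail hMM θ hθ
    rcases List.mem_append.1 hθ with hθ | hθ
    · exact forall_of_modAvail hMS θ hθ
    · exact hmk θ hθ
  refine ModAddU.AssocData.isBlock_flatten _ fun k hk => ?_
  simp only [segsT, List.length_cons, List.length_nil] at hk
  have mem : ∀ {χ} (j : ℕ) (hj : j < k) (hχ : χ ∈ (d.segsT K)[j]'(by simp [segsT]; omega)),
      χ ∈ T ∪ {χ | ∃ j, ∃ hj : j < k, χ ∈ (d.segsT K)[j]'(by simp [segsT]; omega)} := fun j hj hχ => Or.inr ⟨j, hj, hχ⟩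
  have wk : ∀ {θ}, θ ∈ d.wkT → 1 < k → ctx (d.KT K) θ ∈ T ∪ {χ | ∃ j, ∃ hj : j < k, χ ∈ (d.segsT K)[j]'(by simp [segsT]; omega)} :=
    fun hθ hk1 => mem 1 hk1 (Logic.mem_weakLines hθ)
  have wMM : ∀ θ ∈ modDefList d.MM d.L, θ ∈ d.wkT := fun θ hθ => List.mem_append_left _ hθ
  have wMS : ∀ θ ∈ modDefList d.MS d.L, θ ∈ d.wkT := fun θ hθ => List.mem_append_right _ (List.mem_append_left _ hθ)
  have wmk : ∀ θ ∈ d.maskDefs, θ ∈ d.wkT := fun θ hθ => List.mem_append_right _ (List.mem_append_right _ hθ)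
  interval_cases k
  · exact FregeSystem.IsBlock.singleton (Or.inr (Logic.infer hGL 1 (by decide) (FregeSystem.sub [K, var d.g]) rfl
      FregeSystem.prems_nil))
  · exact Logic.isBlock_weakLines hGL K _ fun L hL => Or.inl (hwk L hL)
  · refine Scaffold.isBlock_of_forall fun θ hθ => ?_
    obtain ⟨i, hi, rfl⟩ := List.mem_map.1 hθ
    rw [List.mem_range] at hi
    exact Or.inr (Logic.infer hGL 15 (by decide) (FregeSystem.sub [d.KT K, var (d.mx i), var d.g, var (d.x i)]) rfl
      (FregeSystem.prems_cons (wk (wmk _ (d.mem_maskDefs hi).1) (by omega)) (FregeSystem.prems_cons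
        (mem 0 (by omega) (List.mem_singleton_self _)) FregeSystem.prems_nil)))
  · refine Scaffold.isBlock_of_forall fun θ hθ => ?_
    obtain ⟨i, hi, rfl⟩ := List.mem_map.1 hθ
    rw [List.mem_range] at hi
    exact Or.inr (Logic.infer hGL 15 (by decide) (FregeSystem.sub [d.KT K, var (d.my i), var d.g, var (d.y i)]) rfl
      (FregeSystem.prems_cons (wk (wmk _ (d.mem_maskDefs hi).2.1) (by omega)) (FregeSystem.prems_cons
        (mem 0 (by omega) (List.mem_singleton_self _)) FregeSystem.prems_nil)))
  · refine Scaffold.isBlock_of_forall fun θ hθ => ?_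
    obtain ⟨i, hi, rfl⟩ := List.mem_map.1 hθ
    rw [List.mem_range] at hi
    exact Or.inr (Logic.infer hGL 15 (by decide) (FregeSystem.sub [d.KT K, var (d.mS i), var d.g, var (d.s i)]) rfl
      (FregeSystem.prems_cons (wk (wmk _ (d.mem_maskDefs hi).2.2) (by omega)) (FregeSystem.prems_cons
        (mem 0 (by omega) (List.mem_singleton_self _)) FregeSystem.prems_nil)))
  · exact Adder.isBlock_reflLines hGA _ _ _
  · exact (⟨d.MM, d.MS, d.L⟩ : ModAddU.PairData).isBlock_leibLines hGN hGL
      (modAvail_of_forall fun θ hθ => wk (wMM θ hθ) (by omega)) (modAvail_of_forall fun θ hθ => wk (wMS θ hθ) (by omega))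
      (fun i hi => mem 2 (by omega) (List.mem_map.2 ⟨i, List.mem_range.2 hi, rfl⟩))
      (fun i hi => mem 3 (by omega) (List.mem_map.2 ⟨i, List.mem_range.2 hi, rfl⟩))
      (fun i hi => mem 5 (by omega) (Adder.mem_reflLines (List.mem_map.2 ⟨i, List.mem_range.2 hi, rfl⟩)))
  · refine Scaffold.isBlock_of_forall fun θ hθ => ?_
    obtain ⟨i, hi, rfl⟩ := List.mem_map.1 hθ
    rw [List.mem_range] at hi
    exact Or.inr (ModAddU.glue hGG 2 (by decide) (FregeSystem.sub [d.KT K, var (d.mS i), var (d.s i), var (d.MM.R d.L i)]) rfl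
      (FregeSystem.prems_cons (mem 4 (by omega) (List.mem_map.2 ⟨i, List.mem_range.2 hi, rfl⟩)) (FregeSystem.prems_cons
        (mem 6 (by omega) ((⟨d.MM, d.MS, d.L⟩ : ModAddU.PairData).mem_leibLines hi)) FregeSystem.prems_nil)))

/-- Availability of the shapes of `ZADDF` in the negative branch. [folklore] -/
theorem avail_act {T : Set (PropForm ℕ)} (hMM : d.MM.Avail (d.KF K) T d.L) (hCA : d.CA.Avail (d.KF K) T d.L)
    (hx : ∀ i < d.L, ctx (d.KF K) (neg (var (d.mx i))) ∈ T) (hy : ∀ i < d.L, ctx (d.KF K) (neg (var (d.my i))) ∈ T) :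
    ∀ i < d.L, ∀ φ ∈ ZADDF.shapes, ctx (d.KF K) (inst (d.act i) φ) ∈ T := by
  intro i hi φ hφ
  simp only [ZADDF, List.mem_cons, List.not_mem_nil, or_false] at hφ
  rcases hφ with rfl | rfl | rfl | rfl | rfl | rfl | rfl | rfl
  exacts [(hMM.1.2 i hi).1, (hMM.1.2 i hi).2, hMM.2.1.1 i hi, (hMM.2.1.2.2 i hi).2, hCA.1 i hi, (hCA.2.2 i hi).2, hx i hi, hy i hi]

/-- **The negative branch**: under `¬g`, all masks are false, `mx ⊕ my` has false sum bits and
`¬ge` (system `ZADDF`), so its output is false and equals the false `mS`. [cite: CookReckhow1979, §2] -/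
theorem isBlock_segsF (hGK : ∀ r ∈ maskRules, r ∈ G.rules) (hGL : ∀ r ∈ Logic.rules, r ∈ G.rules) {T : Set (PropForm ℕ)}
    (hMM : d.MM.Avail K T d.L) (hCA : d.CA.Avail K T d.L) (hmk : ∀ θ ∈ d.maskDefs, ctx K θ ∈ T)
    (hlt : ctx K (neg (var (d.CA.ge d.L d.L))) ∈ T) : G.IsBlock T (d.segsF K).flatten := by
  have hwk : ∀ θ ∈ d.wkF, ctx K θ ∈ T := fun θ hθ => by
    rcases List.mem_append.1 hθ with hθ | hθ
    · exact forall_of_modAvail hMM θ hθ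
    rcases List.mem_append.1 hθ with hθ | hθ
    · exact ModAddU.AssocData.forall_of_subAvail hCA θ hθ
    rcases List.mem_append.1 hθ with hθ | hθ
    · exact hmk θ hθ
    · rw [List.mem_singleton.1 hθ]; exact hlt
  refine ModAddU.AssocData.isBlock_flatten _ fun k hk => ?_
  simp only [segsF, List.length_cons, List.length_nil] at hk
  have mem : ∀ {χ} (j : ℕ) (hj : j < k) (hχ : χ ∈ (d.segsF K)[j]'(by simp [segsF]; omega)),
      χ ∈ T ∪ {χ | ∃ j, ∃ hj : j < k, χ ∈ (d.segsF K)[j]'(by simp [segsF]; omega)} := fun j hj hχ => Or.inr ⟨j, hj, hχ⟩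
  have wk : ∀ {θ}, θ ∈ d.wkF → 1 < k → ctx (d.KF K) θ ∈ T ∪ {χ | ∃ j, ∃ hj : j < k, χ ∈ (d.segsF K)[j]'(by simp [segsF]; omega)} :=
    fun hθ hk1 => mem 1 hk1 (Logic.mem_weakLines hθ)
  have wMM : ∀ θ ∈ modDefList d.MM d.L, θ ∈ d.wkF := fun θ hθ => List.mem_append_left _ hθ
  have wCA : ∀ θ ∈ ModAddU.AssocData.subDefList d.CA d.L, θ ∈ d.wkF := fun θ hθ =>
    List.mem_append_right _ (List.mem_append_left _ hθ)
  have wmk : ∀ θ ∈ d.maskDefs, θ ∈ d.wkF := fun θ hθ => List.mem_append_right _ (List.mem_append_right _ (List.mem_append_left _ hθ))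
  have wlt : neg (var (d.CA.ge d.L d.L)) ∈ d.wkF :=
    List.mem_append_right _ (List.mem_append_right _ (List.mem_append_right _ (List.mem_singleton_self _)))
  interval_cases k
  · exact FregeSystem.IsBlock.singleton (Or.inr (Logic.infer hGL 2 (by decide) (FregeSystem.sub [K, var d.g]) rfl
      FregeSystem.prems_nil))
  · exact Logic.isBlock_weakLines hGL K _ fun L hL => Or.inl (hwk L hL)
  · refine Scaffold.isBlock_of_forall fun θ hθ => ?_
    obtain ⟨i, hi, rfl⟩ := List.mem_map.1 hθ
    rw [List.mem_range] at hi
    exact Or.inr (Logic.infer hGL 16 (by decide) (FregeSystem.sub [d.KF K, var (d.mx i), var d.g, var (d.x i)]) rfl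
      (FregeSystem.prems_cons (wk (wmk _ (d.mem_maskDefs hi).1) (by omega)) (FregeSystem.prems_cons
        (mem 0 (by omega) (List.mem_singleton_self _)) FregeSystem.prems_nil)))
  · refine Scaffold.isBlock_of_forall fun θ hθ => ?_
    obtain ⟨i, hi, rfl⟩ := List.mem_map.1 hθ
    rw [List.mem_range] at hi
    exact Or.inr (Logic.infer hGL 16 (by decide) (FregeSystem.sub [d.KF K, var (d.my i), var d.g, var (d.y i)]) rfl
      (FregeSystem.prems_cons (wk (wmk _ (d.mem_maskDefs hi).2.1) (by omega)) (FregeSystem.prems_cons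
        (mem 0 (by omega) (List.mem_singleton_self _)) FregeSystem.prems_nil)))
  · refine Scaffold.isBlock_of_forall fun θ hθ => ?_
    obtain ⟨i, hi, rfl⟩ := List.mem_map.1 hθ
    rw [List.mem_range] at hi
    exact Or.inr (Logic.infer hGL 16 (by decide) (FregeSystem.sub [d.KF K, var (d.mS i), var d.g, var (d.s i)]) rfl
      (FregeSystem.prems_cons (wk (wmk _ (d.mem_maskDefs hi).2.2) (by omega)) (FregeSystem.prems_cons
        (mem 0 (by omega) (List.mem_singleton_self _)) FregeSystem.prems_nil)))
  · -- 5: the induction of `ZADDF`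
    have hMM' : d.MM.Avail (d.KF K) (T ∪ {χ | ∃ j, ∃ hj : j < 5, χ ∈ (d.segsF K)[j]'(by simp [segsF]; omega)}) d.L :=
      modAvail_of_forall fun θ hθ => wk (wMM θ hθ) (by omega)
    have hCA' : d.CA.Avail (d.KF K) (T ∪ {χ | ∃ j, ∃ hj : j < 5, χ ∈ (d.segsF K)[j]'(by simp [segsF]; omega)}) d.L :=
      ModAddU.AssocData.subAvail_of_forall fun θ hθ => wk (wCA θ hθ) (by omega)
    exact System.isBlock_lines zaddfLeavesOK (hGK _ (mem_maskRules (i := 0) (by decide)))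
      (hGK _ (mem_maskRules (i := 1) (by decide))) (d.KF K) d.act d.L
      (ModAddU.hcoh_of (p := fun k => decide (1 ≤ k ∧ k ≤ 3)) (by decide +kernel) fun i _ k hk => by
        simp only [decide_eq_true_eq] at hk
        obtain ⟨hk₁, hk₂⟩ := hk
        interval_cases k <;> rfl)
      (fun φ hφ => by
        simp only [ZADDF, List.mem_cons, List.not_mem_nil, or_false] at hφ
        rcases hφ with rfl | rfl | rfl
        exacts [hMM'.1.1, hMM'.2.1.2.1, hCA'.2.1])
      (d.avail_act hMM' hCA' (fun i hi => mem 2 (by omega) (List.mem_map.2 ⟨i, List.mem_range.2 hi, rfl⟩))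
        (fun i hi => mem 3 (by omega) (List.mem_map.2 ⟨i, List.mem_range.2 hi, rfl⟩)))
  · -- 6: the sum bits of `MM` are false (per-position rule)
    have hMM' : d.MM.Avail (d.KF K) (T ∪ {χ | ∃ j, ∃ hj : j < 6, χ ∈ (d.segsF K)[j]'(by simp [segsF]; omega)}) d.L :=
      modAvail_of_forall fun θ hθ => wk (wMM θ hθ) (by omega)
    have hCA' : d.CA.Avail (d.KF K) (T ∪ {χ | ∃ j, ∃ hj : j < 6, χ ∈ (d.segsF K)[j]'(by simp [segsF]; omega)}) d.L :=
      ModAddU.AssocData.subAvail_of_forall fun θ hθ => wk (wCA θ hθ) (by omega)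
    refine Scaffold.isBlock_of_forall fun θ hθ => ?_
    obtain ⟨i, hi, rfl⟩ := List.mem_map.1 hθ
    rw [List.mem_range] at hi
    exact Or.inr (System.isInferredFrom_end zaddfLeavesOK.inv_ne_zero (hGK _ (mem_maskRules (i := 2) (by decide)))
      zaddfLeavesOK.2.1 (ModAddU.ne_zero_of_allVarsB (by decide +kernel)) (d.KF K) d.act i
      (mem 5 (by omega) (System.mem_lines ZADDF (d.KF K) d.act hi.le))
      (d.avail_act hMM' hCA' (fun i hi => mem 2 (by omega) (List.mem_map.2 ⟨i, List.mem_range.2 hi, rfl⟩))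
        (fun i hi => mem 3 (by omega) (List.mem_map.2 ⟨i, List.mem_range.2 hi, rfl⟩)) i hi))
  · -- 7: `¬ge(MM)` (end rule, from `xa < nw`)
    exact FregeSystem.IsBlock.singleton (Or.inr (System.isInferredFrom_end zaddfLeavesOK.inv_ne_zero
      (hGK _ (mem_maskRules (i := 3) (by decide))) (System.forall_ne_zero_of_shapesOKB (by decide +kernel))
      (ModAddU.ne_zero_of_allVarsB (by decide +kernel)) (d.KF K) d.act d.L
      (mem 5 (by omega) (System.mem_lines ZADDF (d.KF K) d.act le_rfl)) fun φ hφ => by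
        rw [List.mem_singleton.1 hφ]; exact wk wlt (by omega)))
  · -- 8: the output bits of `MM` are false
    refine Scaffold.isBlock_of_forall fun θ hθ => ?_
    obtain ⟨i, hi, rfl⟩ := List.mem_map.1 hθ
    rw [List.mem_range] at hi
    exact Or.inr (FregeSystem.IsInferredFrom.of_rule (hGK _ (mem_maskRules (i := 4) (by decide)))
      (FregeSystem.sub [d.KF K, var (d.MM.R d.L i), var (d.MM.ge d.L), var (d.MM.d d.L i), var (d.MM.S.s i)]) rfl
      (FregeSystem.prems_cons (wk (wMM _ (List.mem_append_right _ (List.mem_append_right _ (List.mem_append_right _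
        (List.mem_append_right _ (List.mem_map.2 ⟨i, List.mem_range.2 hi, rfl⟩)))))) (by omega)) (FregeSystem.prems_cons
        (mem 7 (by omega) (List.mem_singleton_self _)) (FregeSystem.prems_cons (mem 6 (by omega)
          (List.mem_map.2 ⟨i, List.mem_range.2 hi, rfl⟩)) FregeSystem.prems_nil))))
  · -- 9: `mS ↔ R(MM)` (both false)
    refine Scaffold.isBlock_of_forall fun θ hθ => ?_
    obtain ⟨i, hi, rfl⟩ := List.mem_map.1 hθ
    rw [List.mem_range] at hi
    exact Or.inr (Logic.infer hGL 10 (by decide) (FregeSystem.sub [d.KF K, var (d.mS i), var (d.MM.R d.L i)]) rfl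
      (FregeSystem.prems_cons (mem 4 (by omega) (List.mem_map.2 ⟨i, List.mem_range.2 hi, rfl⟩))
        (FregeSystem.prems_cons (mem 8 (by omega) (List.mem_map.2 ⟨i, List.mem_range.2 hi, rfl⟩)) FregeSystem.prems_nil)))

/-- **The mask block**: `mSᵢ ↔ R(mx ⊕ my)ᵢ` for `i < L` — the masks distribute over the
modular sum. [cite: CookReckhow1979, §2] -/
theorem isBlock_maskLines (hGK : ∀ r ∈ maskRules, r ∈ G.rules) (hGN : ∀ r ∈ Netlist.rules, r ∈ G.rules)
    (hGA : ∀ r ∈ Adder.rules, r ∈ G.rules) (hGL : ∀ r ∈ Logic.rules, r ∈ G.rules)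
    (hGG : ∀ r ∈ ModAddU.glueRules, r ∈ G.rules) (hMM : d.MM.Avail K Γ d.L) (hMS : d.MS.Avail K Γ d.L)
    (hCA : d.CA.Avail K Γ d.L) (hmk : ∀ θ ∈ d.maskDefs, ctx K θ ∈ Γ) (hlt : ctx K (neg (var (d.CA.ge d.L d.L))) ∈ Γ) :
    G.IsBlock Γ (d.maskLines K) := by
  refine Logic.isBlock_cases (A := var d.g) hGL (d.isBlock_segsT hGN hGA hGL hGG hMM hMS hmk)
    ((d.isBlock_segsF hGK hGL hMM hCA hmk hlt).mono Set.subset_union_left) (fun Lb hL => ?_) fun Lb hL => ?_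
  · obtain ⟨i, hi, rfl⟩ := List.mem_map.1 hL
    rw [List.mem_range] at hi
    refine Or.inl (Or.inr ?_)
    simp only [Set.mem_setOf_eq, segsT, List.flatten_cons, List.flatten_nil, List.mem_append, List.append_nil]
    iterate 7 refine Or.inr ?_
    exact List.mem_map.2 ⟨i, List.mem_range.2 hi, rfl⟩
  · obtain ⟨i, hi, rfl⟩ := List.mem_map.1 hL
    rw [List.mem_range] at hi
    refine Or.inr ?_
    simp only [Set.mem_setOf_eq, segsF, List.flatten_cons, List.flatten_nil, List.mem_append, List.append_nil]
    iterate 9 refine Or.inr ?_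
    exact List.mem_map.2 ⟨i, List.mem_range.2 hi, rfl⟩

/-- The conclusions of the mask block. [folklore] -/
theorem mem_maskLines {i : ℕ} (hi : i < d.L) : ctx K (eqv (d.mS i) (d.MM.R d.L i)) ∈ d.maskLines K :=
  List.mem_append_right _ (List.mem_map.2 ⟨_, List.mem_map.2 ⟨i, List.mem_range.2 hi, rfl⟩, rfl⟩)

/-- **Every line of the mask block has size `≤ |K| + 70`.** [folklore] -/
theorem bounded_maskLines (K : PropForm ℕ) : ModAddU.Bounded (K.size + 70) (d.maskLines K) := by
  have hT : (d.KT K).size = K.size + 3 := by simp [KT, size]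
  have hF : (d.KF K).size = K.size + 2 := by simp [KF, size]
  have hZ : ZADDF.inv.size = 10 := by decide +kernel
  have hmd : ∀ θ ∈ d.maskDefs, θ.size ≤ 57 := fun θ hθ => by
    simp only [maskDefs, List.mem_append, List.mem_map, List.mem_range] at hθ
    rcases hθ with ⟨i, -, rfl⟩ | ⟨i, -, rfl⟩ | ⟨i, -, rfl⟩ <;> (rw [mdef, FregeSystem.size_biimp]; simp [size])
  have hwT : ∀ θ ∈ d.wkT, θ.size ≤ 57 := fun θ hθ => by
    rcases List.mem_append.1 hθ with hθ | hθ
    · exact size_le_of_mem_modDefList hθ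
    rcases List.mem_append.1 hθ with hθ | hθ
    · exact size_le_of_mem_modDefList hθ
    · exact hmd θ hθ
  have hwF : ∀ θ ∈ d.wkF, θ.size ≤ 57 := fun θ hθ => by
    rcases List.mem_append.1 hθ with hθ | hθ
    · exact size_le_of_mem_modDefList hθ
    rcases List.mem_append.1 hθ with hθ | hθ
    · exact ModAddU.AssocData.size_le_of_mem_subDefList hθ
    rcases List.mem_append.1 hθ with hθ | hθ
    · exact hmd θ hθ
    · rw [List.mem_singleton.1 hθ]; simp [size]
  refine ((ModAddU.Bounded.flatten fun D hD => ?_).append (ModAddU.Bounded.flatten fun D hD => ?_)).append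
    (ModAddU.Bounded.map fun Lb hL => ?_)
  · simp only [segsT, List.mem_cons, List.not_mem_nil, or_false] at hD
    rcases hD with rfl | rfl | rfl | rfl | rfl | rfl | rfl | rfl
    · exact ModAddU.Bounded.singleton (by rw [ModAddU.size_ctx, hT]; simp [size])
    · exact ModAddU.bounded_weak K _ hwT (by simp [size])
    · exact ModAddU.bounded_ctx_eqv _ (by omega) _ _ _
    · exact ModAddU.bounded_ctx_eqv _ (by omega) _ _ _
    · exact ModAddU.bounded_ctx_eqv _ (by omega) _ _ _
    · exact ModAddU.bounded_refl _ _ (by omega)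
    · exact (ModAddU.MFI.bounded_pair _ _ (by omega)).1
    · exact ModAddU.bounded_ctx_eqv _ (by omega) _ _ _
  · simp only [segsF, List.mem_cons, List.not_mem_nil, or_false] at hD
    rcases hD with rfl | rfl | rfl | rfl | rfl | rfl | rfl | rfl | rfl | rfl
    · exact ModAddU.Bounded.singleton (by rw [ModAddU.size_ctx, hF]; simp [size])
    · exact ModAddU.bounded_weak K _ hwF (by simp [size])
    · exact ModAddU.Bounded.map fun i _ => by rw [ModAddU.size_ctx, hF]; simp [size]
    · exact ModAddU.Bounded.map fun i _ => by rw [ModAddU.size_ctx, hF]; simp [size]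
    · exact ModAddU.Bounded.map fun i _ => by rw [ModAddU.size_ctx, hF]; simp [size]
    · exact ModAddU.bounded_sysLines _ _ _ _ (by omega)
    · exact ModAddU.Bounded.map fun i _ => by rw [ModAddU.size_ctx, hF, ModAddU.size_inst]; simp [size]
    · exact ModAddU.Bounded.singleton (by rw [ModAddU.size_ctx, hF, ModAddU.size_inst]; simp [size])
    · exact ModAddU.Bounded.map fun i _ => by rw [ModAddU.size_ctx, hF]; simp [size]
    · exact ModAddU.bounded_ctx_eqv _ (by omega) _ _ _
  · obtain ⟨i, -, rfl⟩ := List.mem_map.1 hL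
    rw [ModAddU.size_ctx, FregeSystem.size_eqv]; omega

/-- **The mask block has `46L + 14` lines.** [folklore] -/
theorem length_maskLines (K : PropForm ℕ) : (d.maskLines K).length = 46 * d.L + 14 := by
  simp only [maskLines, segsT, segsF, concls, wkT, wkF, maskDefs, List.flatten_cons, List.flatten_nil, List.length_append,
    List.length_cons, List.length_nil, List.length_map, List.length_range, Logic.weakLines, Logic.mergeLines,
    length_modDefList, ModAddU.AssocData.subDefList, Adder.reflLines, ModAddU.PairData.leibLines, ModAddU.PairData.tail,
    Adder.leibLines, Sub.leibLines, System.lines, List.append_nil]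
  ring

/-- **Size of the mask block**: `≤ (46L + 14)(|K| + 70)`. [folklore] -/
theorem proofSize_maskLines (K : PropForm ℕ) : proofSize (d.maskLines K) ≤ (46 * d.L + 14) * (K.size + 70) := by
  rw [← d.length_maskLines K]; exact (d.bounded_maskLines K).proofSize_le

end MaskData

end LD

end ModMulU

end Literature.Computability.MetaComplexity
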